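import Mathlib
import Literature.Computability.AlgebraicComplexity.SymmetricArithCircuit
import Literature.Computability.AlgebraicComplexity.DawarWilsenach2025
import Summits.ValiantsHypothesis.ValiantsHypothesis.Theses.ProofCarryingSymmetry
import Summits.ValiantsHypothesis.ValiantsHypothesis.Theses.MonotoneRestoration

/-! Strategist s3 scratch (crux `RestorationQP`, stmt-ValiantsHypothesis-10343):
first lemma of the negation-lens idea `pfaffian-doubling`, and the typed pieces of the
orbit cut recorded in STRATEGY-CENSUS-s3.md (none filed as items). -/

set_option linter.dupNamespace false

open Literature.Computability.AlgebraicComplexity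

namespace Summit.ValiantsHypothesis.ValiantsHypothesis.Cruxes.RestorationQP.PfaffianDoubling

/-- PFAFFIAN-PAIR RUNG (idea `pfaffian-doubling`, first lemma). The diagonally `S_n`-invariant VP
family `Pf(X - Xᵀ) · Pf(X² - (X²)ᵀ)` — typed without a Pfaffian as "some polynomial square root `Q_n`
of `det(X - Xᵀ) · det(X² - (X²)ᵀ)`" (at even `n` the product is a nonzero square, so `Q_n = ± Pf·Pf`;
at odd `n` it is `0`) — is computed by `S_n`-symmetric circuits of polynomial size. Proof intended:
Ω-doubling (`K = A ⊕ B` on `Fin n ⊕ Fin n`, `Ω` the `S_n`-fixed symplectic pairing, `Pf(Ω+S) =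
Pf(Ω) · [deg ≤ n] exp(½ Σ_k (-1)^{k+1} tr((Ω⁻¹S)^k)/k)`), all gates equivariant. -/
def PfaffianPairRestorable : Prop :=
  ∃ c : ℕ, ∀ n : ℕ, ∃ (G : Type) (_ : Fintype G)
    (C : LabelledArithCircuit ℂ (Fin n × Fin n) Unit G),
    C.IsSymmetric (Equiv.Perm (Fin n)) ∧
    C.eval (C.output ()) ^ 2 =
      ((Matrix.mvPolynomialX (Fin n) (Fin n) ℂ) - (Matrix.mvPolynomialX (Fin n) (Fin n) ℂ).transpose).det *
      ((Matrix.mvPolynomialX (Fin n) (Fin n) ℂ) ^ 2 -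
        ((Matrix.mvPolynomialX (Fin n) (Fin n) ℂ) ^ 2).transpose).det ∧
    Fintype.card G ≤ (n + 2) ^ c

/-- ORBIT CUT, piece A (diagonal form of the sibling crux `OrbitRestorationQP`, stmt-18293):
invariant VP families have symmetric circuits of quasi-polynomial ORBIT size. Recorded, not filed. -/
def OrbitRestorationDiagQP : Prop :=
  ∀ f : (n : ℕ) → MvPolynomial (Fin n × Fin n) ℂ,
    (∀ (n : ℕ) (σ : Equiv.Perm (Fin n)),
      MvPolynomial.rename (fun x : Fin n × Fin n => σ • x) (f n) = f n) →
    IsVPFamily f →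
    ∃ c : ℕ, ∀ n : ℕ, ∃ (G : Type) (_ : Fintype G)
      (C : LabelledArithCircuit ℂ (Fin n × Fin n) Unit G),
      C.IsSymmetric (Equiv.Perm (Fin n)) ∧ C.eval (C.output ()) = f n ∧
      C.orbitSize (Equiv.Perm (Fin n)) ≤ 2 ^ ((Nat.log 2 n + c) ^ c)

/-- ORBIT CUT, piece B (diagonal form of the sibling aside `OrbitCompressionQP`, stmt-18295):
qp orbits + VP ⇒ qp size. Recorded, not filed. -/
def OrbitCompressionDiagQP : Prop :=
  ∀ f : (n : ℕ) → MvPolynomial (Fin n × Fin n) ℂ,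
    (∀ (n : ℕ) (σ : Equiv.Perm (Fin n)),
      MvPolynomial.rename (fun x : Fin n × Fin n => σ • x) (f n) = f n) →
    IsVPFamily f →
    (∃ c : ℕ, ∀ n : ℕ, ∃ (G : Type) (_ : Fintype G)
      (C : LabelledArithCircuit ℂ (Fin n × Fin n) Unit G),
      C.IsSymmetric (Equiv.Perm (Fin n)) ∧ C.eval (C.output ()) = f n ∧
      C.orbitSize (Equiv.Perm (Fin n)) ≤ 2 ^ ((Nat.log 2 n + c) ^ c)) →
    ∃ c : ℕ, ∀ n : ℕ, ∃ (G : Type) (_ : Fintype G)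
      (C : LabelledArithCircuit ℂ (Fin n × Fin n) Unit G),
      C.IsSymmetric (Equiv.Perm (Fin n)) ∧ C.eval (C.output ()) = f n ∧
      Fintype.card G ≤ 2 ^ ((Nat.log 2 n + c) ^ c)

/-- The orbit cut reassembles the crux (modus ponens; the seam is trivial, the content is in A). -/
theorem restorationQP_of_orbitCut (hA : OrbitRestorationDiagQP) (hB : OrbitCompressionDiagQP) :
    Summit.ValiantsHypothesis.ValiantsHypothesis.Theses.ProofCarryingSymmetry.RestorationQP :=
  fun f hf hVP => hB f hf hVP (hA f hf hVP)

/-- Crux ⇒ piece A (an orbit is a set of gates: `orbitSize_le_size`; `size = Fintype.card G`). -/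
theorem orbitRestorationDiagQP_of_restorationQP
    (h : Summit.ValiantsHypothesis.ValiantsHypothesis.Theses.ProofCarryingSymmetry.RestorationQP) :
    OrbitRestorationDiagQP := by
  intro f hf hVP
  obtain ⟨c, hc⟩ := h f hf hVP
  refine ⟨c, fun n => ?_⟩
  obtain ⟨G, hG, C, hsym, hev, hcard⟩ := hc n
  exact ⟨G, hG, C, hsym, hev, ((C.orbitSize_le_size _).trans (le_of_eq rfl)).trans hcard⟩

/-- Piece A ⇒ the sibling route's deciding crux `OrbitRestorationQP` (stmt-18293): matrix symmetry
(independent row/column permutations) implies diagonal invariance. -/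
theorem orbitRestorationQP_of_diag (hA : OrbitRestorationDiagQP) :
    Summit.ValiantsHypothesis.ValiantsHypothesis.Theses.MonotoneRestoration.OrbitRestorationQP := by
  intro f hms hVP
  refine hA f (fun n σ => ?_) hVP
  have h := hms n σ σ
  have hfun : (fun x : Fin n × Fin n => σ • x) = fun p : Fin n × Fin n => (σ p.1, σ p.2) := by
    funext p
    rfl
  rw [hfun]
  exact h

/-- Hence piece A ALONE decides the summit (through the sibling's certified `closes`): the orbit cut
of `RestorationQP` is not an admissible decomposition (one piece gives S), and its summit-carrying
piece is the sibling route's crux up to the hypothesis group. -/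
theorem valiantsHypothesis_of_orbitRestorationDiagQP (hA : OrbitRestorationDiagQP) :
    _root_.ValiantsHypothesis :=
  Summit.ValiantsHypothesis.ValiantsHypothesis.Theses.MonotoneRestoration.closes
    (orbitRestorationQP_of_diag hA)

/-- … and the sibling's kill witnesses kill this crux too: `¬ OrbitRestorationQP → ¬ RestorationQP`. -/
theorem not_restorationQP_of_not_orbitRestorationQP
    (h : ¬ Summit.ValiantsHypothesis.ValiantsHypothesis.Theses.MonotoneRestoration.OrbitRestorationQP) :
    ¬ Summit.ValiantsHypothesis.ValiantsHypothesis.Theses.ProofCarryingSymmetry.RestorationQP :=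
  fun hR => h (orbitRestorationQP_of_diag (orbitRestorationDiagQP_of_restorationQP hR))

end Summit.ValiantsHypothesis.ValiantsHypothesis.Cruxes.RestorationQP.PfaffianDoubling
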